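import Literature.Analysis.FluidPDE.TaoAveragedRotations
import Mathlib.Analysis.Quaternion
import Mathlib.MeasureTheory.Measure.Haar.InnerProductSpace
import HarnessLib

/-!
# Rotations of `ℝ³` by quaternion conjugation (for the rotation averaging of Tao 2016, §3.6–§3.7)

T. Tao, *Finite time blowup for an averaged three-dimensional Navier–Stokes equation*,
J. Amer. Math. Soc. **29** (2016), 601–674 = arXiv:1402.0290v3, §3.6–§3.7 (pp. 18–19), averages
the symbol `Λ` over rotation triples `(R₁, R₂, R₃) ∈ SO(3)³` with Haar measure ("`dR₁ dR₂ dR₃`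
denote Haar measure on `SO(3)`", p. 18) and uses, inside that average, left translations by the
rotations `R^θ_ξ` about varying axes and by a common rotation `S` ((3.19)–(3.20)).  To carry this
out without a theory of Haar measure on `SO(3)`, the formalisation parametrises rotations by
non-zero quaternions `q ∈ ℍ` acting on `ℝ³ = Im ℍ` by conjugation, `ρ(q) v = q v q̄ / |q|²`:
left and right multiplication by unit quaternions are then *linear isometries of `ℍ ≅ ℝ⁴`*, hence
preserve Lebesgue measure, which is all the invariance the averaging argument needs.

This file supplies the algebra of that action:

* `quatOf`, `vecOf` — `ℝ³ ↔ Im ℍ`; `quatOf_mul_quatOf` (`a b = -a·b + a × b`);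
* `qrotFun q` — **the conjugation action** `v ↦ |q|⁻² Im(q v q̄)`, linear, isometric
  (`norm_qrotFun`), multiplicative (`qrotFun_mul`), `qrotFun (star q) = (qrotFun q)⁻¹`,
  homogeneous of degree `0` in `q`; `qrot q : ℝ³ ≃ₗᵢ[ℝ] ℝ³` (identity at `q = 0`) with
  **`det_qrot : det ρ(q) = 1`** (so `ρ(q) ∈ SO(3)`, via the square root `|q| + q`);
* `quatExp u θ = cos(θ/2) + sin(θ/2) u` and **Euler–Rodrigues** `qrotFun_quatExp`:
  `ρ(quatExp u θ) = R^θ_u` (the tree's `rodRot`, Tao's footnote 6 p. 19);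
* `cross_qrotFun` — `ρ(q)` commutes with the cross product (orientation preserving);
* `exists_unit_qrotFun_eq`, `exists_unit_qrotFun_frame_eq` — unit quaternions moving a unit
  vector, resp. an orthonormal pair, to another (transitivity, by explicit half-turns; no appeal
  to Euler's rotation theorem);
* `quatLmul`, `quatRmul` — left/right multiplication by a unit quaternion as linear isometric
  automorphisms of `ℍ`, and `lintegral_comp_quat_mul_left/right` — **invariance of Lebesgue
  measure on `ℍ`** under them (the substitute for Haar measure), w.r.t. the Borel structure
  `quatMeasurableSpace` (a `def` used as a *local* instance, not a global instance on `ℍ`);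
* smoothness (`contDiffAt_qrotFun`) and measurability (`measurable_qrot_apply`).

## References

* T. Tao, J. Amer. Math. Soc. 29 (2016), 601–674, arXiv:1402.0290v3, §3.6–3.7 pp. 18–19,
  footnote 6. Key `Tao2016AveragedNS`.
-/

noncomputable section

open Real MeasureTheory Quaternion
open scoped RealInnerProductSpace Quaternion

namespace Literature.Analysis.FluidPDE.Tao2016

/-- Local notation for physical / frequency space `ℝ³`. -/
local notation "ℝ³" => EuclideanSpace ℝ (Fin 3)

/-! ### Pure quaternions and vectors -/

/-- The pure quaternion `(0, v₀, v₁, v₂)` of a vector `v ∈ ℝ³`. [folklore] -/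
def quatOf (v : ℝ³) : ℍ := ⟨0, v 0, v 1, v 2⟩

/-- The vector (imaginary) part of a quaternion, as an element of `ℝ³`. [folklore] -/
def vecOf (q : ℍ) : ℝ³ := !₂[q.imI, q.imJ, q.imK]

/-- Components of `quatOf`. [folklore] -/
@[simp] theorem quatOf_re (v : ℝ³) : (quatOf v).re = 0 := rfl
/-- Components of `quatOf`. [folklore] -/
@[simp] theorem quatOf_imI (v : ℝ³) : (quatOf v).imI = v 0 := rfl
/-- Components of `quatOf`. [folklore] -/
@[simp] theorem quatOf_imJ (v : ℝ³) : (quatOf v).imJ = v 1 := rfl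
/-- Components of `quatOf`. [folklore] -/
@[simp] theorem quatOf_imK (v : ℝ³) : (quatOf v).imK = v 2 := rfl
/-- Components of `vecOf`. [folklore] -/
@[simp] theorem vecOf_apply_zero (q : ℍ) : vecOf q 0 = q.imI := by simp [vecOf]
/-- Components of `vecOf`. [folklore] -/
@[simp] theorem vecOf_apply_one (q : ℍ) : vecOf q 1 = q.imJ := by simp [vecOf]
/-- Components of `vecOf`. [folklore] -/
@[simp] theorem vecOf_apply_two (q : ℍ) : vecOf q 2 = q.imK := by simp [vecOf]

/-- `vecOf ∘ quatOf = id`. [folklore] -/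
@[simp] theorem vecOf_quatOf (v : ℝ³) : vecOf (quatOf v) = v := by
  ext i; fin_cases i <;> simp

/-- `quatOf (vecOf q) = q` for a pure quaternion. [folklore] -/
theorem quatOf_vecOf {q : ℍ} (hq : q.re = 0) : quatOf (vecOf q) = q := by
  ext <;> simp [hq]

/-- `quatOf` is additive. [folklore] -/
theorem quatOf_add (v w : ℝ³) : quatOf (v + w) = quatOf v + quatOf w := by
  ext <;> simp

/-- `quatOf` commutes with real scalars. [folklore] -/
theorem quatOf_smul (c : ℝ) (v : ℝ³) : quatOf (c • v) = c • quatOf v := by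
  ext <;> simp

/-- `quatOf` of a negative. [folklore] -/
theorem quatOf_neg (v : ℝ³) : quatOf (-v) = -quatOf v := by
  ext <;> simp

/-- `vecOf` is additive. [folklore] -/
theorem vecOf_add (p q : ℍ) : vecOf (p + q) = vecOf p + vecOf q := by
  ext i; fin_cases i <;> simp

/-- `vecOf` commutes with real scalars. [folklore] -/
theorem vecOf_smul (c : ℝ) (q : ℍ) : vecOf (c • q) = c • vecOf q := by
  ext i; fin_cases i <;> simp

/-- `vecOf` of a real quaternion vanishes. [folklore] -/
@[simp] theorem vecOf_coe (c : ℝ) : vecOf (c : ℍ) = 0 := by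
  ext i; fin_cases i <;> simp

/-- `vecOf 0 = 0`. [folklore] -/
@[simp] theorem vecOf_zero : vecOf 0 = 0 := by
  ext i; fin_cases i <;> simp

/-- `star (0, v) = (0, -v)`. [folklore] -/
theorem star_quatOf (v : ℝ³) : star (quatOf v) = -quatOf v := by
  ext <;> simp

/-- **`a b = -(a · b) + a × b`** for pure quaternions. [folklore] -/
theorem quatOf_mul_quatOf (a b : ℝ³) :
    quatOf a * quatOf b = -((⟪a, b⟫ : ℝ) : ℍ) + quatOf (cross a b) := by
  ext <;> simp [real_inner_fin3, cross_apply_zero, cross_apply_one, cross_apply_two] <;> ring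

/-- `normSq (0, v) = |v|²`. [folklore] -/
theorem normSq_quatOf (v : ℝ³) : normSq (quatOf v) = ‖v‖ ^ 2 := by
  rw [normSq_def', EuclideanSpace.norm_sq_eq]
  simp [Fin.sum_univ_three, quatOf]

/-- `|(0, v)| = |v|`. [folklore] -/
theorem norm_quatOf (v : ℝ³) : ‖quatOf v‖ = ‖v‖ := by
  have h := normSq_quatOf v
  rw [normSq_eq_norm_mul_self, ← sq] at h
  exact (sq_eq_sq₀ (norm_nonneg _) (norm_nonneg _)).1 h

/-- `|vecOf q| = |q|` for a pure quaternion. [folklore] -/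
theorem norm_vecOf {q : ℍ} (hq : q.re = 0) : ‖vecOf q‖ = ‖q‖ := by
  rw [← norm_quatOf, quatOf_vecOf hq]

/-- A unit pure quaternion squares to `-1`: `(0,u)(0,u) = -|u|²`. [folklore] -/
theorem quatOf_mul_self (u : ℝ³) : quatOf u * quatOf u = -((‖u‖ ^ 2 : ℝ) : ℍ) := by
  rw [quatOf_mul_quatOf, cross_self_eq_zero, real_inner_self_eq_norm_sq]
  ext <;> simp

/-! ### The conjugation action `ρ(q) v = q v q̄ / |q|²` -/

/-- **The rotation `ρ(q)` of `ℝ³` by the quaternion `q`**: `ρ(q) v = |q|⁻² Im(q (0,v) q̄)`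
(junk `0` at `q = 0`, since `0⁻¹ = 0`). [folklore] -/
def qrotFun (q : ℍ) (v : ℝ³) : ℝ³ := (normSq q)⁻¹ • vecOf (q * quatOf v * star q)

/-- `q (0,v) q̄` is pure. [folklore] -/
@[simp] theorem conj_quatOf_re (q : ℍ) (v : ℝ³) : (q * quatOf v * star q).re = 0 := by
  simp [quatOf]; ring

/-- `ρ(q)` is additive. [folklore] -/
theorem qrotFun_add (q : ℍ) (v w : ℝ³) : qrotFun q (v + w) = qrotFun q v + qrotFun q w := by
  simp only [qrotFun, quatOf_add, mul_add, add_mul, vecOf_add, smul_add]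

/-- `ρ(q)` commutes with scalars. [folklore] -/
theorem qrotFun_smul (q : ℍ) (c : ℝ) (v : ℝ³) : qrotFun q (c • v) = c • qrotFun q v := by
  simp only [qrotFun, quatOf_smul, mul_smul_comm, smul_mul_assoc, vecOf_smul, smul_comm c]

/-- `ρ(q) 0 = 0`. [folklore] -/
@[simp] theorem qrotFun_zero_right (q : ℍ) : qrotFun q 0 = 0 := by
  simpa using qrotFun_smul q 0 0

/-- `ρ(q)(-v) = -ρ(q) v`. [folklore] -/
theorem qrotFun_neg (q : ℍ) (v : ℝ³) : qrotFun q (-v) = -qrotFun q v := by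
  simpa using qrotFun_smul q (-1) v

/-- **`ρ(q)` is an isometry** for `q ≠ 0`: `|q v q̄| = |q|² |v|`. [folklore] -/
theorem norm_qrotFun {q : ℍ} (hq : q ≠ 0) (v : ℝ³) : ‖qrotFun q v‖ = ‖v‖ := by
  have hN : 0 < normSq q := by
    rcases (normSq_nonneg (a := q)).lt_or_eq with h | h
    · exact h
    · exact absurd (normSq_eq_zero.1 h.symm) hq
  rw [qrotFun, norm_smul, norm_inv, Real.norm_of_nonneg hN.le, norm_vecOf (conj_quatOf_re q v),
    norm_mul, norm_mul, norm_star, norm_quatOf, normSq_eq_norm_mul_self]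
  have hn : ‖q‖ ≠ 0 := norm_ne_zero_iff.mpr hq
  field_simp

/-- **`ρ` is multiplicative**: `ρ(ab) = ρ(a) ρ(b)` (for all `a, b`; both sides vanish if
`a = 0` or `b = 0`). [folklore] -/
theorem qrotFun_mul (a b : ℍ) (v : ℝ³) : qrotFun (a * b) v = qrotFun a (qrotFun b v) := by
  have hpure : (b * quatOf v * star b).re = 0 := conj_quatOf_re b v
  rw [qrotFun, qrotFun, qrotFun, quatOf_smul, quatOf_vecOf hpure, mul_smul_comm, smul_mul_assoc,
    vecOf_smul, smul_smul, map_mul, mul_inv, star_mul]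
  congr 2
  simp only [mul_assoc]

/-- `ρ(1) = id`. [folklore] -/
@[simp] theorem qrotFun_one (v : ℝ³) : qrotFun 1 v = v := by
  simp [qrotFun]

/-- **`ρ` is homogeneous of degree `0`**: `ρ(c q) = ρ(q)` for real `c ≠ 0`. [folklore] -/
theorem qrotFun_smul_left {c : ℝ} (hc : c ≠ 0) (q : ℍ) (v : ℝ³) :
    qrotFun (c • q) v = qrotFun q v := by
  rw [qrotFun, qrotFun, Quaternion.star_smul, smul_mul_assoc, smul_mul_assoc, mul_smul_comm, smul_smul,
    vecOf_smul, smul_smul, normSq_smul]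
  by_cases hq : q = 0
  · simp [hq]
  · have hN : normSq q ≠ 0 := fun h => hq (normSq_eq_zero.1 h)
    congr 1
    field_simp

/-- `ρ(c) = id` for a non-zero real quaternion `c`. [folklore] -/
theorem qrotFun_coe {c : ℝ} (hc : c ≠ 0) (v : ℝ³) : qrotFun (c : ℍ) v = v := by
  have : (c : ℍ) = c • (1 : ℍ) := by ext <;> simp
  rw [this, qrotFun_smul_left hc, qrotFun_one]

/-- **`ρ(q̄) = ρ(q)⁻¹`**: `ρ(q̄)(ρ(q) v) = v` (`q ≠ 0`). [folklore] -/
theorem qrotFun_star_self {q : ℍ} (hq : q ≠ 0) (v : ℝ³) : qrotFun (star q) (qrotFun q v) = v := by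
  rw [← qrotFun_mul, star_mul_self, qrotFun_coe (fun h => hq (normSq_eq_zero.1 h))]

/-- `ρ(q)(ρ(q̄) v) = v` (`q ≠ 0`). [folklore] -/
theorem qrotFun_self_star {q : ℍ} (hq : q ≠ 0) (v : ℝ³) : qrotFun q (qrotFun (star q) v) = v := by
  simpa using qrotFun_star_self (star_ne_zero.mpr hq) v

/-- The axis is fixed: `ρ(q) (Im q) = Im q`. [folklore] -/
theorem qrotFun_vecOf_self (q : ℍ) : qrotFun q (vecOf q) = vecOf q := by
  by_cases hq : q = 0
  · simp [hq, qrotFun]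
  have hN : normSq q ≠ 0 := fun h => hq (normSq_eq_zero.1 h)
  have key : q * quatOf (vecOf q) * star q = normSq q • quatOf (vecOf q) := by
    ext <;> simp [normSq_def'] <;> ring
  rw [qrotFun, key, vecOf_smul, smul_smul, inv_mul_cancel₀ hN, one_smul, vecOf_quatOf]

/-! ### `ρ(q)` as an element of `SO(3)` -/

/-- `ρ(q)` as a linear map. [folklore] -/
def qrotLinear (q : ℍ) : ℝ³ →ₗ[ℝ] ℝ³ where
  toFun := qrotFun q
  map_add' := qrotFun_add q
  map_smul' c v := qrotFun_smul q c v

/-- `ρ(q)` as a linear isometry (`q ≠ 0`). [folklore] -/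
def qrotIsometry {q : ℍ} (hq : q ≠ 0) : ℝ³ →ₗᵢ[ℝ] ℝ³ :=
  ⟨qrotLinear q, norm_qrotFun hq⟩

open Classical in
/-- **The rotation `ρ(q) ∈ SO(3)` of a quaternion `q`** as a linear isometric automorphism of
`ℝ³` (the conjugation action for `q ≠ 0`; the identity for `q = 0`). [folklore] -/
def qrot (q : ℍ) : ℝ³ ≃ₗᵢ[ℝ] ℝ³ :=
  if hq : q = 0 then LinearIsometryEquiv.refl ℝ ℝ³ else (qrotIsometry hq).toLinearIsometryEquiv rfl

/-- `qrot q` acts by `qrotFun q` (`q ≠ 0`). [folklore] -/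
theorem qrot_apply {q : ℍ} (hq : q ≠ 0) (v : ℝ³) : qrot q v = qrotFun q v := by
  simp only [qrot, hq, ↓reduceDIte]
  rfl

/-- `qrot 0 = id`. [folklore] -/
@[simp] theorem qrot_zero_apply (v : ℝ³) : qrot 0 v = v := by
  simp [qrot]

/-- `qrot 1 = id`. [folklore] -/
@[simp] theorem qrot_one_apply (v : ℝ³) : qrot 1 v = v := by
  rw [qrot_apply one_ne_zero, qrotFun_one]

/-- `qrot (ab) = qrot a ∘ qrot b` (`a, b ≠ 0`). [folklore] -/
theorem qrot_mul_apply {a b : ℍ} (ha : a ≠ 0) (hb : b ≠ 0) (v : ℝ³) :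
    qrot (a * b) v = qrot a (qrot b v) := by
  rw [qrot_apply (mul_ne_zero ha hb), qrot_apply ha, qrot_apply hb, qrotFun_mul]

/-- **`(qrot q)⁻¹ = qrot q̄`** (for all `q`, the case `q = 0` being `id = id`). [folklore] -/
theorem qrot_symm_apply (q : ℍ) (v : ℝ³) : (qrot q).symm v = qrot (star q) v := by
  by_cases hq : q = 0
  · subst hq; simp [qrot]; rfl
  · apply (qrot q).injective
    rw [LinearIsometryEquiv.apply_symm_apply, qrot_apply hq, qrot_apply (star_ne_zero.mpr hq),
      qrotFun_self_star hq]

/-- `qrot (c • q) = qrot q` for real `c ≠ 0`. [folklore] -/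
theorem qrot_smul_apply {c : ℝ} (hc : c ≠ 0) (q : ℍ) (v : ℝ³) : qrot (c • q) v = qrot q v := by
  by_cases hq : q = 0
  · subst hq; simp
  · rw [qrot_apply (smul_ne_zero hc hq), qrot_apply hq, qrotFun_smul_left hc]

/-- The underlying linear map of `qrot q` (`q ≠ 0`). [folklore] -/
theorem qrot_toLinearMap {q : ℍ} (hq : q ≠ 0) :
    ((qrot q).toLinearEquiv : ℝ³ →ₗ[ℝ] ℝ³) = qrotLinear q :=
  LinearMap.ext fun v => qrot_apply hq v

/-- `q² = 2 (Re q) q - |q|²`. [folklore] -/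
theorem quat_mul_self (q : ℍ) : q * q = (2 * q.re) • q - ((normSq q : ℝ) : ℍ) := by
  have h1 : ((normSq q : ℝ) : ℍ) = ⟨normSq q, 0, 0, 0⟩ := rfl
  rw [h1]
  ext <;> simp [normSq_def'] <;> ring

/-- A quaternion with `Re q = -|q|` is real (and non-positive). [folklore] -/
theorem eq_coe_of_re_eq_neg_norm {q : ℍ} (h : q.re = -‖q‖) : q = ((q.re : ℝ) : ℍ) := by
  have hsq : normSq q = q.re ^ 2 := by
    rw [normSq_eq_norm_mul_self, h]; ring
  rw [normSq_def'] at hsq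
  have h1 : q.imI = 0 := by nlinarith [sq_nonneg q.imI, sq_nonneg q.imJ, sq_nonneg q.imK]
  have h2 : q.imJ = 0 := by nlinarith [sq_nonneg q.imI, sq_nonneg q.imJ, sq_nonneg q.imK]
  have h3 : q.imK = 0 := by nlinarith [sq_nonneg q.imI, sq_nonneg q.imJ, sq_nonneg q.imK]
  ext <;> simp [h1, h2, h3]

/-- **`det ρ(q) = 1`**: a linear isometry has `|det| = 1`, and `ρ(q) = ρ(h)²` for the square
root `h = |q| + q` of (a positive multiple of) `q` has non-negative determinant. [folklore] -/
theorem det_qrot (q : ℍ) : LinearMap.det ((qrot q).toLinearEquiv : ℝ³ →ₗ[ℝ] ℝ³) = 1 := by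
  by_cases hq : q = 0
  · subst hq
    have : ((qrot 0).toLinearEquiv : ℝ³ →ₗ[ℝ] ℝ³) = LinearMap.id := LinearMap.ext fun v => by simp
    rw [this, LinearMap.det_id]
  rw [qrot_toLinearMap hq]
  have habs : |LinearMap.det (qrotLinear q)| = 1 := by
    rw [← LinearMap.normDet_eq_abs_det]
    exact (qrotIsometry hq).normDet_eq_one
  -- the square root `h = |q| + q`, with `h² = 2(|q| + Re q) q`
  set c : ℝ := 2 * (‖q‖ + q.re) with hc
  by_cases hc0 : c = 0
  · -- then `q` is a negative real and `ρ(q) = id`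
    have hre : q.re = -‖q‖ := by rw [hc] at hc0; linarith
    have hq' : q = ((q.re : ℝ) : ℍ) := eq_coe_of_re_eq_neg_norm hre
    have hre0 : q.re ≠ 0 := by
      intro h0; apply hq; rw [hq', h0]; rfl
    have : qrotLinear q = LinearMap.id := by
      refine LinearMap.ext fun v => ?_
      change qrotFun q v = v
      rw [hq']; exact qrotFun_coe hre0 v
    rw [this, LinearMap.det_id]
  set h : ℍ := ((‖q‖ : ℝ) : ℍ) + q with hh
  have hn : ‖q‖ * ‖q‖ = q.re ^ 2 + q.imI ^ 2 + q.imJ ^ 2 + q.imK ^ 2 := by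
    rw [← normSq_eq_norm_mul_self, normSq_def']
  have hsq : h * h = c • q := by
    ext <;> simp [hh, hc] <;> first | linear_combination hn | ring
  have hh0 : h ≠ 0 := by
    intro h0
    have : c • q = 0 := by rw [← hsq, h0, zero_mul]
    exact (smul_ne_zero hc0 hq) this
  have hfac : qrotLinear q = qrotLinear h ∘ₗ qrotLinear h := by
    refine LinearMap.ext fun v => ?_
    change qrotFun q v = qrotFun h (qrotFun h v)
    rw [← qrotFun_mul, hsq, qrotFun_smul_left hc0]
  have hnonneg : 0 ≤ LinearMap.det (qrotLinear q) := by
    rw [hfac, LinearMap.det_comp]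
    exact mul_self_nonneg _
  rw [abs_of_nonneg hnonneg] at habs
  exact habs

/-- The inner product is preserved: `ρ(q) a · ρ(q) b = a · b` (`q ≠ 0`). [folklore] -/
theorem inner_qrotFun {q : ℍ} (hq : q ≠ 0) (a b : ℝ³) : ⟪qrotFun q a, qrotFun q b⟫ = ⟪a, b⟫ :=
  (qrotIsometry hq).inner_map_map a b

/-! ### Euler–Rodrigues: `ρ(cos(θ/2) + sin(θ/2) u) = R^θ_u` -/

/-- The general conjugation formula for `p = c + s (0,u)`:
`p (0,v) p̄ = (0, c² v + 2cs (u × v) - s² (|u|² v - 2 (u·v) u))`. [folklore] -/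
theorem conj_coe_add_smul_quatOf (c s : ℝ) (u v : ℝ³) :
    ((c : ℍ) + s • quatOf u) * quatOf v * star ((c : ℍ) + s • quatOf u) =
      quatOf (c ^ 2 • v + (2 * c * s) • cross u v - s ^ 2 • (‖u‖ ^ 2 • v - (2 * ⟪u, v⟫) • u)) := by
  have hu : ‖u‖ ^ 2 = u 0 ^ 2 + u 1 ^ 2 + u 2 ^ 2 := by
    rw [EuclideanSpace.norm_sq_eq]; simp [Fin.sum_univ_three]
  ext <;> simp [real_inner_fin3, cross_apply_zero, cross_apply_one, cross_apply_two, hu] <;> ring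

/-- **The half-angle quaternion** `quatExp u θ = cos(θ/2) + sin(θ/2) (0, u)` (a unit quaternion
when `|u| = 1`, with `ρ(quatExp u θ) = R^θ_u`). [folklore] -/
def quatExp (u : ℝ³) (θ : ℝ) : ℍ := ((Real.cos (θ / 2) : ℝ) : ℍ) + Real.sin (θ / 2) • quatOf u

/-- `normSq (quatExp u θ) = cos² + sin² |u|²`. [folklore] -/
theorem normSq_quatExp (u : ℝ³) (θ : ℝ) :
    normSq (quatExp u θ) = Real.cos (θ / 2) ^ 2 + Real.sin (θ / 2) ^ 2 * ‖u‖ ^ 2 := by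
  have hu : ‖u‖ ^ 2 = u 0 ^ 2 + u 1 ^ 2 + u 2 ^ 2 := by
    rw [EuclideanSpace.norm_sq_eq]; simp [Fin.sum_univ_three]
  rw [quatExp, normSq_def', hu]
  simp
  ring

/-- `|quatExp u θ| = 1` for a unit axis. [folklore] -/
theorem norm_quatExp {u : ℝ³} (hu : ‖u‖ = 1) (θ : ℝ) : ‖quatExp u θ‖ = 1 := by
  have h := normSq_quatExp u θ
  rw [hu, one_pow, mul_one, Real.cos_sq_add_sin_sq, normSq_eq_norm_mul_self] at h
  nlinarith [norm_nonneg (quatExp u θ)]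

/-- `quatExp u θ ≠ 0` for a unit axis. [folklore] -/
theorem quatExp_ne_zero {u : ℝ³} (hu : ‖u‖ = 1) (θ : ℝ) : quatExp u θ ≠ 0 := by
  intro h
  have := norm_quatExp hu θ
  rw [h, norm_zero] at this
  exact zero_ne_one this

/-- `quatExp u 0 = 1`. [folklore] -/
@[simp] theorem quatExp_zero (u : ℝ³) : quatExp u 0 = 1 := by
  simp [quatExp]

/-- **Euler–Rodrigues**: conjugation by `cos(θ/2) + sin(θ/2) u` is the rotation `R^θ_u` by `θ`
about the unit axis `u` (Tao's `R_ξ^θ`, footnote 6 p. 19, for `ξ = u`). [cite: Tao2016AveragedNS, §3.7 footnote 6 p. 19] -/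
theorem qrotFun_quatExp {u : ℝ³} (hu : ‖u‖ = 1) (θ : ℝ) (v : ℝ³) :
    qrotFun (quatExp u θ) v = rodRot u θ v := by
  have hN : normSq (quatExp u θ) = 1 := by
    rw [normSq_quatExp, hu, one_pow, mul_one, Real.cos_sq_add_sin_sq]
  rw [qrotFun, hN, inv_one, one_smul, quatExp, conj_coe_add_smul_quatOf, vecOf_quatOf, hu, one_pow,
    one_smul]
  have hud : udir u = u := by rw [udir, hu, inv_one, one_smul]
  rw [rodRot, hud, real_inner_comm v u]
  have hc2 : Real.cos (θ / 2) ^ 2 = 1 - Real.sin (θ / 2) ^ 2 := by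
    linarith [Real.cos_sq_add_sin_sq (θ / 2)]
  have hc : Real.cos θ = 1 - 2 * Real.sin (θ / 2) ^ 2 := by
    conv_lhs => rw [show θ = 2 * (θ / 2) by ring, Real.cos_two_mul]
    linarith [Real.cos_sq_add_sin_sq (θ / 2)]
  have hs : Real.sin θ = 2 * Real.cos (θ / 2) * Real.sin (θ / 2) := by
    conv_lhs => rw [show θ = 2 * (θ / 2) by ring, Real.sin_two_mul]
    ring
  rw [hs, hc, hc2]
  module

/-- `ρ(quatExp u θ)` as `qrot`. [cite: Tao2016AveragedNS, §3.7 footnote 6 p. 19] -/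
theorem qrot_quatExp {u : ℝ³} (hu : ‖u‖ = 1) (θ : ℝ) (v : ℝ³) : qrot (quatExp u θ) v = rodRot u θ v := by
  rw [qrot_apply (quatExp_ne_zero hu θ), qrotFun_quatExp hu]

/-- `ρ(quatExp u θ)` fixes its axis. [folklore] -/
theorem qrotFun_quatExp_axis {u : ℝ³} (hu : ‖u‖ = 1) (θ : ℝ) : qrotFun (quatExp u θ) u = u := by
  rw [qrotFun_quatExp hu, rodRot_axis]

/-! ### `ρ(q)` preserves the cross product (it is orientation preserving) -/

/-- **`ρ(q) a × ρ(q) b = ρ(q)(a × b)`** (`q ≠ 0`): the conjugation action commutes with the cross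
product. [folklore] -/
theorem cross_qrotFun {q : ℍ} (hq : q ≠ 0) (a b : ℝ³) :
    cross (qrotFun q a) (qrotFun q b) = qrotFun q (cross a b) := by
  have hN : normSq q ≠ 0 := fun h => hq (normSq_eq_zero.1 h)
  -- polynomial identity `Im(q a q̄) × Im(q b q̄) = |q|² Im(q (a×b) q̄)`
  have key : cross (vecOf (q * quatOf a * star q)) (vecOf (q * quatOf b * star q)) =
      normSq q • vecOf (q * quatOf (cross a b) * star q) := by
    ext i
    fin_cases i <;> simp [cross_apply_zero, cross_apply_one, cross_apply_two, normSq_def'] <;> ring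
  rw [qrotFun, qrotFun, qrotFun, cross_smul_left, cross_smul_right, key, smul_smul, smul_smul]
  congr 1
  field_simp

/-! ### Transitivity: unit quaternions moving a unit vector / an orthonormal pair -/

/-- Conjugation by a pure quaternion `(0, b)` is the half-turn about `b`:
`ρ((0,b)) v = -v + 2 (b·v)/|b|² b`. [folklore] -/
theorem qrotFun_quatOf {b : ℝ³} (hb : b ≠ 0) (v : ℝ³) :
    qrotFun (quatOf b) v = -v + (2 * ⟪b, v⟫ / ‖b‖ ^ 2) • b := by
  have h := conj_coe_add_smul_quatOf 0 1 b v
  simp only [Quaternion.coe_zero, zero_add, one_smul, zero_pow two_ne_zero, zero_smul, mul_zero,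
    zero_mul, one_pow, zero_sub] at h
  have hb2 : ‖b‖ ^ 2 ≠ 0 := pow_ne_zero 2 (norm_ne_zero_iff.mpr hb)
  rw [qrotFun, h, vecOf_quatOf, normSq_quatOf]
  rw [smul_neg, smul_sub, smul_smul, smul_smul, inv_mul_cancel₀ hb2, one_smul, div_eq_inv_mul]
  abel

/-- A unit vector orthogonal to a given non-zero vector. [folklore] -/
theorem exists_unit_orthogonal {e : ℝ³} (he : e ≠ 0) : ∃ m : ℝ³, ‖m‖ = 1 ∧ ⟪m, e⟫ = 0 := by
  -- one of `e × e₀`, `e × e₁` is non-zero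
  by_cases h0 : cross e (EuclideanSpace.single 0 1) = 0
  · have h1 : cross e (EuclideanSpace.single 1 1) ≠ 0 := by
      intro h1
      apply he
      have c0 := congrArg (fun w : ℝ³ => w 1) h0
      have c1 := congrArg (fun w : ℝ³ => w 2) h0
      have c2 := congrArg (fun w : ℝ³ => w 2) h1
      simp [cross_apply_one, cross_apply_two] at c0 c1 c2
      ext i; fin_cases i
      · exact c2
      · exact c1
      · exact c0
    refine ⟨udir (cross e (EuclideanSpace.single 1 1)), norm_udir h1, ?_⟩
    rw [udir, real_inner_smul_left, inner_cross_self_left, mul_zero]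
  · refine ⟨udir (cross e (EuclideanSpace.single 0 1)), norm_udir h0, ?_⟩
    rw [udir, real_inner_smul_left, inner_cross_self_left, mul_zero]

/-- **Transitivity on the sphere**: for unit vectors `e, v` there is a unit quaternion `s` with
`ρ(s) e = v` (the half-turn about the bisector `e + v`, or about any axis `⊥ e` if `v = -e`). [folklore] -/
theorem exists_unit_qrotFun_eq {e v : ℝ³} (he : ‖e‖ = 1) (hv : ‖v‖ = 1) :
    ∃ s : ℍ, ‖s‖ = 1 ∧ qrotFun s e = v := by
  have he0 : e ≠ 0 := by
    intro h; rw [h, norm_zero] at he; exact zero_ne_one he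
  by_cases hb : e + v = 0
  · -- antipodal: half-turn about a unit `m ⊥ e`
    have hv' : v = -e := by rw [add_eq_zero_iff_eq_neg] at hb; rw [hb, neg_neg]
    obtain ⟨m, hm1, hme⟩ := exists_unit_orthogonal he0
    have hm0 : m ≠ 0 := by
      intro h; rw [h, norm_zero] at hm1; exact zero_ne_one hm1
    refine ⟨quatOf m, by rw [norm_quatOf, hm1], ?_⟩
    rw [qrotFun_quatOf hm0, hme, mul_zero, zero_div, zero_smul, add_zero, hv']
  · set b : ℝ³ := e + v with hbdef
    have hbe : ⟪b, e⟫ = 1 + ⟪v, e⟫ := by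
      rw [hbdef, inner_add_left, real_inner_self_eq_norm_sq, he, one_pow]
    have hbb : ‖b‖ ^ 2 = 2 * (1 + ⟪v, e⟫) := by
      rw [hbdef, ← real_inner_self_eq_norm_sq, inner_add_left, inner_add_right, inner_add_right,
        real_inner_self_eq_norm_sq, real_inner_self_eq_norm_sq, he, hv, real_inner_comm e v]
      ring
    have hb2 : ‖b‖ ^ 2 ≠ 0 := pow_ne_zero 2 (norm_ne_zero_iff.mpr hb)
    refine ⟨(‖quatOf b‖⁻¹ : ℝ) • quatOf b, norm_smul_inv_norm (by rwa [ne_eq, ← norm_eq_zero,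
      norm_quatOf, norm_eq_zero]), ?_⟩
    rw [qrotFun_smul_left (inv_ne_zero (by rwa [norm_quatOf, norm_ne_zero_iff])), qrotFun_quatOf hb,
      hbe]
    have : 2 * (1 + ⟪v, e⟫) / ‖b‖ ^ 2 = 1 := by
      rw [hbb, div_self]; rwa [← hbb]
    rw [this, one_smul, hbdef]
    abel

/-- **Transitivity on orthonormal pairs**: for orthonormal pairs `(e, m)` and `(e', m')` there is
a unit quaternion `s` with `ρ(s) e = e'` and `ρ(s) m = m'` (first move `e` to `e'`, then rotate
about `e'` using the polar form in the plane `e'^⊥`). [folklore] -/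
theorem exists_unit_qrotFun_frame_eq {e m e' m' : ℝ³} (he : ‖e‖ = 1) (hm : ‖m‖ = 1) (hem : ⟪m, e⟫ = 0)
    (he' : ‖e'‖ = 1) (hm' : ‖m'‖ = 1) (hem' : ⟪m', e'⟫ = 0) :
    ∃ s : ℍ, ‖s‖ = 1 ∧ qrotFun s e = e' ∧ qrotFun s m = m' := by
  obtain ⟨s₁, hs₁, hs₁e⟩ := exists_unit_qrotFun_eq he he'
  have hs₁0 : s₁ ≠ 0 := by
    intro h; rw [h, norm_zero] at hs₁; exact zero_ne_one hs₁
  have he'0 : e' ≠ 0 := by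
    intro h; rw [h, norm_zero] at he'; exact zero_ne_one he'
  -- `m₁ = ρ(s₁) m` is a unit vector orthogonal to `e'`
  set m₁ := qrotFun s₁ m with hm₁
  have hm₁1 : ‖m₁‖ = 1 := by rw [hm₁, norm_qrotFun hs₁0, hm]
  have hm₁e : ⟪m₁, e'⟫ = 0 := by rw [hm₁, ← hs₁e, inner_qrotFun hs₁0, hem]
  -- rotate `m₁` to `m'` about `e'`
  obtain ⟨α, hα⟩ := exists_eq_norm_smul_rodRot he'0 hm₁1 hm₁e hem'
  rw [hm', one_smul] at hα
  refine ⟨quatExp e' α * s₁, by rw [norm_mul, norm_quatExp he', hs₁, one_mul], ?_, ?_⟩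
  · rw [qrotFun_mul, hs₁e, qrotFun_quatExp_axis he']
  · rw [qrotFun_mul, ← hm₁, qrotFun_quatExp he', ← hα]

/-! ### Left and right multiplication by unit quaternions: isometries of `ℍ ≅ ℝ⁴` -/

/-- The unit quaternion `q/|q|` (junk `0` at `q = 0`). [folklore] -/
def quatUnit (q : ℍ) : ℍ := (‖q‖⁻¹ : ℝ) • q

/-- `|q/|q|| = 1` for `q ≠ 0`. [folklore] -/
theorem norm_quatUnit {q : ℍ} (hq : q ≠ 0) : ‖quatUnit q‖ = 1 := norm_smul_inv_norm hq

/-- `ρ(q/|q|) = ρ(q)`. [folklore] -/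
theorem qrotFun_quatUnit {q : ℍ} (hq : q ≠ 0) (v : ℝ³) : qrotFun (quatUnit q) v = qrotFun q v :=
  qrotFun_smul_left (inv_ne_zero (norm_ne_zero_iff.mpr hq)) q v

/-- `q̄/|q| · q = |q|`: `star (quatUnit q) * q` is the real quaternion `|q|`. [folklore] -/
theorem star_quatUnit_mul_self (q : ℍ) : star (quatUnit q) * q = ((‖q‖ : ℝ) : ℍ) := by
  by_cases hq : q = 0
  · subst hq; simp [quatUnit]
  rw [quatUnit, Quaternion.star_smul, smul_mul_assoc, star_mul_self, normSq_eq_norm_mul_self]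
  have hn : ‖q‖ ≠ 0 := norm_ne_zero_iff.mpr hq
  ext <;> simp [hn]

/-- **Left multiplication by a unit quaternion** as a linear isometric automorphism of `ℍ`. [folklore] -/
def quatLmul (p : ℍ) (hp : ‖p‖ = 1) : ℍ ≃ₗᵢ[ℝ] ℍ where
  toLinearEquiv := LinearEquiv.ofBijective (LinearMap.mulLeft ℝ p) (by
    have hp0 : p ≠ 0 := by
      intro h; rw [h, norm_zero] at hp; exact zero_ne_one hp
    constructor
    · intro a b hab
      simpa [LinearMap.mulLeft_apply, hp0] using hab
    · intro b
      exact ⟨p⁻¹ * b, by simp [LinearMap.mulLeft_apply, hp0]⟩)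
  norm_map' a := by
    change ‖p * a‖ = ‖a‖
    rw [norm_mul, hp, one_mul]

/-- `quatLmul p` acts by `q ↦ p q`. [folklore] -/
@[simp] theorem quatLmul_apply (p : ℍ) (hp : ‖p‖ = 1) (q : ℍ) : quatLmul p hp q = p * q := rfl

/-- **Right multiplication by a unit quaternion** as a linear isometric automorphism of `ℍ`. [folklore] -/
def quatRmul (p : ℍ) (hp : ‖p‖ = 1) : ℍ ≃ₗᵢ[ℝ] ℍ where
  toLinearEquiv := LinearEquiv.ofBijective (LinearMap.mulRight ℝ p) (by
    have hp0 : p ≠ 0 := by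
      intro h; rw [h, norm_zero] at hp; exact zero_ne_one hp
    constructor
    · intro a b hab
      simpa [LinearMap.mulRight_apply, hp0] using hab
    · intro b
      exact ⟨b * p⁻¹, by simp [LinearMap.mulRight_apply, hp0]⟩)
  norm_map' a := by
    change ‖a * p‖ = ‖a‖
    rw [norm_mul, hp, mul_one]

/-- `quatRmul p` acts by `q ↦ q p`. [folklore] -/
@[simp] theorem quatRmul_apply (p : ℍ) (hp : ‖p‖ = 1) (q : ℍ) : quatRmul p hp q = q * p := rfl

/-! ### Lebesgue measure on `ℍ` and its invariance under unit quaternions -/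

/-- The Borel σ-algebra on `ℍ` (used as a *local* instance: Mathlib equips `ℍ` with no
measurable structure, and we do not register a global one on a Mathlib type). With it, `volume`
on `ℍ` is the Lebesgue (Haar) measure of the real inner product space `ℍ ≅ ℝ⁴`
(`measureSpaceOfInnerProductSpace`). [folklore] -/
@[reducible] def quatMeasurableSpace : MeasurableSpace ℍ := borel ℍ

attribute [local instance] quatMeasurableSpace

/-- `ℍ` with `quatMeasurableSpace` is a Borel space. [folklore] -/
theorem quatBorelSpace : BorelSpace ℍ := ⟨rfl⟩

attribute [local instance] quatBorelSpace

/-- **Invariance of Lebesgue measure on `ℍ` under left multiplication by a unit quaternion**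
(lower Lebesgue integral form): `∫ f(p q) dq = ∫ f(q) dq`. This is the substitute for the left
invariance of Haar measure on `SO(3)` in Tao's "`dR₁ dR₂ dR₃` denote Haar measure" (§3.6 p. 18). [folklore] -/
theorem lintegral_comp_quat_mul_left {p : ℍ} (hp : ‖p‖ = 1) (f : ℍ → ENNReal) :
    ∫⁻ q, f (p * q) = ∫⁻ q, f q :=
  (quatLmul p hp).measurePreserving.lintegral_comp_emb (quatLmul p hp).toHomeomorph.measurableEmbedding f

/-- **Invariance of Lebesgue measure on `ℍ` under right multiplication by a unit quaternion**:
`∫ f(q p) dq = ∫ f(q) dq`. [folklore] -/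
theorem lintegral_comp_quat_mul_right {p : ℍ} (hp : ‖p‖ = 1) (f : ℍ → ENNReal) :
    ∫⁻ q, f (q * p) = ∫⁻ q, f q :=
  (quatRmul p hp).measurePreserving.lintegral_comp_emb (quatRmul p hp).toHomeomorph.measurableEmbedding f

/-- Bochner form of `lintegral_comp_quat_mul_left`. [folklore] -/
theorem integral_comp_quat_mul_left {E : Type*} [NormedAddCommGroup E] [NormedSpace ℝ E] {p : ℍ}
    (hp : ‖p‖ = 1) (f : ℍ → E) : ∫ q, f (p * q) = ∫ q, f q :=
  (quatLmul p hp).measurePreserving.integral_comp (quatLmul p hp).toHomeomorph.measurableEmbedding f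

/-- Bochner form of `lintegral_comp_quat_mul_right`. [folklore] -/
theorem integral_comp_quat_mul_right {E : Type*} [NormedAddCommGroup E] [NormedSpace ℝ E] {p : ℍ}
    (hp : ‖p‖ = 1) (f : ℍ → E) : ∫ q, f (q * p) = ∫ q, f q :=
  (quatRmul p hp).measurePreserving.integral_comp (quatRmul p hp).toHomeomorph.measurableEmbedding f

/-! ### Regularity: smoothness away from `q = 0`, measurability -/

/-- The components of a quaternion are smooth (linear) functions. [folklore] -/
theorem contDiff_quat_re {n : WithTop ℕ∞} : ContDiff ℝ n fun q : ℍ => q.re :=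
  (EuclideanSpace.proj (0 : Fin 4)).contDiff.comp linearIsometryEquivTuple.contDiff

/-- The components of a quaternion are smooth (linear) functions. [folklore] -/
theorem contDiff_quat_imI {n : WithTop ℕ∞} : ContDiff ℝ n fun q : ℍ => q.imI :=
  (EuclideanSpace.proj (1 : Fin 4)).contDiff.comp linearIsometryEquivTuple.contDiff

/-- The components of a quaternion are smooth (linear) functions. [folklore] -/
theorem contDiff_quat_imJ {n : WithTop ℕ∞} : ContDiff ℝ n fun q : ℍ => q.imJ :=
  (EuclideanSpace.proj (2 : Fin 4)).contDiff.comp linearIsometryEquivTuple.contDiff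

/-- The components of a quaternion are smooth (linear) functions. [folklore] -/
theorem contDiff_quat_imK {n : WithTop ℕ∞} : ContDiff ℝ n fun q : ℍ => q.imK :=
  (EuclideanSpace.proj (3 : Fin 4)).contDiff.comp linearIsometryEquivTuple.contDiff

/-- `vecOf` is smooth (linear). [folklore] -/
theorem contDiff_vecOf {n : WithTop ℕ∞} : ContDiff ℝ n vecOf := by
  rw [contDiff_euclidean]
  intro i
  fin_cases i
  · simpa using contDiff_quat_imI
  · simpa using contDiff_quat_imJ
  · simpa using contDiff_quat_imK

/-- `quatOf` is smooth (linear). [folklore] -/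
theorem contDiff_quatOf {n : WithTop ℕ∞} : ContDiff ℝ n quatOf := by
  have h : quatOf = fun v : ℝ³ => linearIsometryEquivTuple.symm (!₂[(0 : ℝ), v 0, v 1, v 2]) := by
    funext v; ext <;> simp [quatOf]
  rw [h]
  refine linearIsometryEquivTuple.symm.contDiff.comp ?_
  rw [contDiff_euclidean]
  intro i
  fin_cases i
  · simpa using contDiff_const
  · simpa using (EuclideanSpace.proj (0 : Fin 3) : ℝ³ →L[ℝ] ℝ).contDiff
  · simpa using (EuclideanSpace.proj (1 : Fin 3) : ℝ³ →L[ℝ] ℝ).contDiff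
  · simpa using (EuclideanSpace.proj (2 : Fin 3) : ℝ³ →L[ℝ] ℝ).contDiff

/-- The coercion `ℝ → ℍ` is smooth (linear). [folklore] -/
theorem contDiff_quat_coe {n : WithTop ℕ∞} : ContDiff ℝ n fun x : ℝ => (x : ℍ) := by
  have h : (fun x : ℝ => (x : ℍ)) =
      fun x : ℝ => linearIsometryEquivTuple.symm (x • (!₂[(1 : ℝ), 0, 0, 0] : EuclideanSpace ℝ (Fin 4))) := by
    funext x; ext <;> simp
  rw [h]
  exact linearIsometryEquivTuple.symm.contDiff.comp (contDiff_id.smul contDiff_const)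

/-- `star` is smooth on `ℍ` (it is `q ↦ 2 Re q - q`). [folklore] -/
theorem contDiff_quat_star {n : WithTop ℕ∞} : ContDiff ℝ n fun q : ℍ => star q := by
  have h : (fun q : ℍ => star q) = fun q : ℍ => (((2 * q.re : ℝ) : ℍ)) - q := by
    funext q; ext <;> simp; ring
  rw [h]
  exact (contDiff_quat_coe.comp (contDiff_const.mul contDiff_quat_re)).sub contDiff_id

/-- `normSq` is smooth on `ℍ` (a quadratic form). [folklore] -/
theorem contDiff_normSq {n : WithTop ℕ∞} : ContDiff ℝ n fun q : ℍ => normSq q := by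
  have h : (fun q : ℍ => normSq q) = fun q : ℍ => q.re ^ 2 + q.imI ^ 2 + q.imJ ^ 2 + q.imK ^ 2 := by
    funext q; exact normSq_def' q
  rw [h]
  exact ((contDiff_quat_re.pow 2).add (contDiff_quat_imI.pow 2)).add (contDiff_quat_imJ.pow 2) |>.add
    (contDiff_quat_imK.pow 2)

/-- **`(q, v) ↦ ρ(q) v` is smooth on `{q ≠ 0}`** (a rational function of `q`, linear in `v`). [folklore] -/
theorem contDiffAt_qrotFun {n : WithTop ℕ∞} {p : ℍ × ℝ³} (hp : p.1 ≠ 0) :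
    ContDiffAt ℝ n (fun x : ℍ × ℝ³ => qrotFun x.1 x.2) p := by
  unfold qrotFun
  have hN : normSq p.1 ≠ 0 := fun h => hp (normSq_eq_zero.1 h)
  have h1 : ContDiffAt ℝ n (fun x : ℍ × ℝ³ => (normSq x.1)⁻¹) p :=
    ((contDiff_normSq.comp contDiff_fst).contDiffAt).inv hN
  have h2 : ContDiffAt ℝ n (fun x : ℍ × ℝ³ => x.1 * quatOf x.2 * star x.1) p :=
    ((contDiffAt_fst.mul (contDiff_quatOf.contDiffAt.comp p contDiffAt_snd)).mul
      (contDiff_quat_star.contDiffAt.comp p contDiffAt_fst))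
  exact h1.smul (contDiff_vecOf.contDiffAt.comp p h2)

/-- `q ↦ ρ(q) v` is continuous on `{q ≠ 0}`. [folklore] -/
theorem continuousAt_qrotFun {q : ℍ} (hq : q ≠ 0) (v : ℝ³) : ContinuousAt (fun q : ℍ => qrotFun q v) q := by
  have h := (contDiffAt_qrotFun (n := 0) (p := (q, v)) hq).continuousAt
  exact ContinuousAt.comp (g := fun x : ℍ × ℝ³ => qrotFun x.1 x.2) (f := fun q' : ℍ => (q', v)) h
    (continuousAt_id.prodMk continuousAt_const)

/-- `q ↦ ρ(q) v` (with its junk value at `0`) is measurable. [folklore] -/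
theorem measurable_qrotFun_apply (v : ℝ³) : Measurable fun q : ℍ => qrotFun q v := by
  unfold qrotFun
  refine (continuous_normSq.measurable.inv).smul ?_
  exact (contDiff_vecOf (n := 0)).continuous.measurable.comp
    (((continuous_id.mul continuous_const).mul (contDiff_quat_star (n := 0)).continuous).measurable)

open Classical in
/-- **`q ↦ qrot q v` is measurable** (the measurability of the rotation families
`ω ↦ R_{j,ω}` of Def. 3.4 built from quaternion coordinates). [cite: Tao2016AveragedNS, Def. 3.4] -/
theorem measurable_qrot_apply (v : ℝ³) : Measurable fun q : ℍ => qrot q v := by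
  have h : (fun q : ℍ => qrot q v) = fun q : ℍ => if q = 0 then v else qrotFun q v := by
    funext q
    by_cases hq : q = 0
    · subst hq; simp
    · rw [if_neg hq, qrot_apply hq]
  rw [h]
  exact Measurable.ite (measurableSet_singleton 0) measurable_const (measurable_qrotFun_apply v)

end Literature.Analysis.FluidPDE.Tao2016
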